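import Summits.HodgeConjecture.HodgeConjecture.Theorems.F0P3cDbTEnvelopeTrichotomy         -- ★ brings `MemXiFamily`, `CMCharIdentityPackageTestSigned`, (H₇), `xiLocalChar` (the socket's cone, as in S5 file D)
import Literature.NumberTheory.Rogawski1990.CharIdentityOnTestFunctionsSignedLemmas        -- ★ `CMNonsplitCharIdentityAtTestSigned.πs` ∕ `.charIdentityAtTestSigned_πs`
import Literature.NumberTheory.Rogawski1990.FinExplicitTransferFactorConjLeft              -- ★ print's `Δ‴`: `finExplicitCollection`, `finExplicitDelta_conj_left_all`
import Literature.NumberTheory.Rogawski1990.FinExplicitTransferFactorConjRight             -- ★ `finExplicitDelta_conj_right_all`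
import Literature.NumberTheory.Automorphic.OrbitalMeasureCanonical                         -- ★ `OrbitalMeasureFamily.IsCanonical`, `IsLocalGRegular`, `IsRegularElt`
import Summits.HodgeConjecture.HodgeConjecture.Theorems.F0P3cStCharTSCharField             -- ★ `qsForm_map_cmConjRingHom_transpose` : `(σΦ₃)ᵀ = Φ₃`
import Summits.HodgeConjecture.HodgeConjecture.Theorems.F0P3cStCharTSShellOrbitalGCan      -- ★ `F0P3cStCharTSShellOrbitalG.isUnit_det_qsForm` : `IsUnit (det Φ₃)`
import HarnessLib

/-!
# R90-TF · S5 «Ch. 13.3 multiplicity ∕ rigidity» — the CONVERSE certificate `(QS-U) ⟹ (β)@Φ₃`: S5#4's «SC-UNIQUE ON U(Φ₃)» implies the LH10 leaf letter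
# (O2♮) `StubXiPacketRigidCoreSc` read at `H := qsForm L` (so, with the sibling file `R90S5QsScUniqueOfRigidCoreScQs`, (QS-U) ⟺ (β)@Φ₃ over ★)

Cell `hodgecm-mathlib`, crux H413 (`stmt-HodgeConjecture-24833`), route of record `HCCMUnconditional`; programme R90-TF (brief `director/R90-BRIEF.v2.md`
1f40d54518340a35), section S5 = Ch. 13.3 (base `R90-C133`), seat R90-C133-p01 (g0), socket S5#4 `R90.S5.stub_R90_1335_qsXiRigidity` ROAD α, DEAL-S5-WAVE1 +
ADDENDUM 1 «CENSUS-FIRST».  Lane `--supports stmt-HodgeConjecture-24833 --as helper`; ONE theorem, no definition, no instance, no notation, no `sorry`; Lines-free,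
so both sides are stated BY NAME-SHAPE: the hypothesis `HU` is the body of `R90.S5.SocketQsScUnique` (S5 file D `Lines/R90_S5_QuasiSplitRigidityD.lean` :163–:231)
TOKEN FOR TOKEN, the conclusion is the body of `F0P3cDbTPaydown.StubXiPacketRigidCoreSc` (`Lines/F0_P3c_DbTPaydown.lean` :342) with `H` INSTANTIATED at `qsForm L`
and `hH ∕ hHd` at the two ★ lemmas — byte-identical with the hypothesis of the sibling `qsScUnique_of_rigidCoreScQs`.
HONEST LABEL: HC_CM is proved only modulo the 7 printed citations (2 remaining named inputs: hLiu418 = stmt-HodgeConjecture-24832, h413 = stmt-HodgeConjecture-24833)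
until rung 0 closes; this file proves NO printed statement — it is the trivial direction of a junction certificate (the chosen partner satisfies its own identity).

THE PROOF.  `HU` gives `c = hId.πs` for `hId := (hQS ξ).1 v hns T a ha h μZ π2 πn hK hn`; substitute and use ★ `CMNonsplitCharIdentityAtTestSigned.charIdentityAtTestSigned_πs`.

[cite: Rogawski1990, §13.3 Thm. 13.3.5 p. 202, Thm. 13.3.6 (c) p. 202; §13.1 Prop. 13.1.3 (d), Prop. 13.1.4 p. 199; §4.9 p. 55] [cite: LanglandsShelstad1987, §1]
-/

set_option autoImplicit false
-- the mandated namespace repeats the single-problem summit's segment (`HodgeConjecture.HodgeConjecture`)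
set_option linter.dupNamespace false

noncomputable section

open NumberField IsDedekindDomain MeasureTheory
open scoped Matrix ComplexOrder

open Literature.NumberTheory Literature.NumberTheory.Automorphic Literature.NumberTheory.Automorphic.UnitaryGroup
open Literature.NumberTheory.Automorphic.IdeleClassGroup
open Literature.NumberTheory.GaloisRepresentations
open Literature.NumberTheory.Rogawski1990
open Summit.HodgeConjecture.HodgeConjecture.Cruxes.H413

namespace Summit.HodgeConjecture.HodgeConjecture.R90.S5

set_option synthInstance.maxHeartbeats 400000 in
set_option maxHeartbeats 8000000 in
open scoped Classical in
/-- **`(QS-U) ⟹ (β)@Φ₃`** — the converse junction certificate: if every supercuspidal `v`-constituent `c` of `P` IS `((hQS ξ).1 v …).πs` (the body of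
`R90.S5.SocketQsScUnique`, hypothesis `HU`), then `⟨πⁿ(ξ_v) ∘ e, some c⟩` satisfies the SIGNED [13.1.4] on test functions at print's pinned data (the LH10 leaf letter
`StubXiPacketRigidCoreSc` read at `H := qsForm L`) — because the chosen partner does (★ `charIdentityAtTestSigned_πs`).  Trivial direction; with
`qsScUnique_of_rigidCoreScQs` it certifies (QS-U) ⟺ (β)@Φ₃ over ★. [cite: Rogawski1990, §13.1 Prop. 13.1.3 (d), Prop. 13.1.4 p. 199; §13.3 Thm. 13.3.5 p. 202] -/
theorem rigidCoreScQs_of_qsScUnique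
    (HU :
      ∀ (L : Type) [Field L] [NumberField L] [IsCMField L]
        [∀ v : HeightOneSpectrum (𝓞 ↥(maximalRealSubfield L)), MeasurableSpace ((cmDatum L 3 (qsForm L)).Local v)]
        [∀ v : HeightOneSpectrum (𝓞 ↥(maximalRealSubfield L)),
          MeasurableSpace ((cmDatum L 2 (Matrix.of fun i j : Fin 2 => if i.val + j.val + 1 = 2 then (1 : L) else 0)).Local v ×
            (cmDatum L 1 (Matrix.of fun i j : Fin 1 => if i.val + j.val + 1 = 1 then (1 : L) else 0)).Local v)]
        [∀ (v : HeightOneSpectrum (𝓞 ↥(maximalRealSubfield L)))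
            (a : ((cmDatum L 2 (Matrix.of fun i j : Fin 2 => if i.val + j.val + 1 = 2 then (1 : L) else 0)).Local v ×
              (cmDatum L 1 (Matrix.of fun i j : Fin 1 => if i.val + j.val + 1 = 1 then (1 : L) else 0)).Local v)),
          MeasurableSpace (((cmDatum L 2 (Matrix.of fun i j : Fin 2 => if i.val + j.val + 1 = 2 then (1 : L) else 0)).Local v ×
              (cmDatum L 1 (Matrix.of fun i j : Fin 1 => if i.val + j.val + 1 = 1 then (1 : L) else 0)).Local v) ⧸
            Subgroup.centralizer ({a} : Set ((cmDatum L 2 (Matrix.of fun i j : Fin 2 => if i.val + j.val + 1 = 2 then (1 : L) else 0)).Local v ×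
              (cmDatum L 1 (Matrix.of fun i j : Fin 1 => if i.val + j.val + 1 = 1 then (1 : L) else 0)).Local v)))]
        [∀ (v : HeightOneSpectrum (𝓞 ↥(maximalRealSubfield L))) (γ : (cmDatum L 3 (qsForm L)).Local v),
          MeasurableSpace ((cmDatum L 3 (qsForm L)).Local v ⧸ Subgroup.centralizer ({γ} : Set ((cmDatum L 3 (qsForm L)).Local v)))]
        (Δ : ∀ v : HeightOneSpectrum (𝓞 ↥(maximalRealSubfield L)), LocalTransferFactor L (qsForm L) v)
        (mH : ∀ v : HeightOneSpectrum (𝓞 ↥(maximalRealSubfield L)),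
          OrbitalMeasureFamily ((cmDatum L 2 (Matrix.of fun i j : Fin 2 => if i.val + j.val + 1 = 2 then (1 : L) else 0)).Local v ×
            (cmDatum L 1 (Matrix.of fun i j : Fin 1 => if i.val + j.val + 1 = 1 then (1 : L) else 0)).Local v))
        (mG : ∀ v : HeightOneSpectrum (𝓞 ↥(maximalRealSubfield L)), OrbitalMeasureFamily ((cmDatum L 3 (qsForm L)).Local v))
        (νG : ∀ v : HeightOneSpectrum (𝓞 ↥(maximalRealSubfield L)), Measure ((cmDatum L 3 (qsForm L)).Local v))
        (νH : ∀ v : HeightOneSpectrum (𝓞 ↥(maximalRealSubfield L)),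
          Measure ((cmDatum L 2 (Matrix.of fun i j : Fin 2 => if i.val + j.val + 1 = 2 then (1 : L) else 0)).Local v ×
            (cmDatum L 1 (Matrix.of fun i j : Fin 1 => if i.val + j.val + 1 = 1 then (1 : L) else 0)).Local v))
        [∀ v : HeightOneSpectrum (𝓞 ↥(maximalRealSubfield L)), BorelSpace ((cmDatum L 3 (qsForm L)).Local v)]
        [∀ v : HeightOneSpectrum (𝓞 ↥(maximalRealSubfield L)),
          BorelSpace ((cmDatum L 2 (Matrix.of fun i j : Fin 2 => if i.val + j.val + 1 = 2 then (1 : L) else 0)).Local v ×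
            (cmDatum L 1 (Matrix.of fun i j : Fin 1 => if i.val + j.val + 1 = 1 then (1 : L) else 0)).Local v)]
        [∀ (v : HeightOneSpectrum (𝓞 ↥(maximalRealSubfield L)))
            (a : ((cmDatum L 2 (Matrix.of fun i j : Fin 2 => if i.val + j.val + 1 = 2 then (1 : L) else 0)).Local v ×
              (cmDatum L 1 (Matrix.of fun i j : Fin 1 => if i.val + j.val + 1 = 1 then (1 : L) else 0)).Local v)),
          BorelSpace (((cmDatum L 2 (Matrix.of fun i j : Fin 2 => if i.val + j.val + 1 = 2 then (1 : L) else 0)).Local v ×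
              (cmDatum L 1 (Matrix.of fun i j : Fin 1 => if i.val + j.val + 1 = 1 then (1 : L) else 0)).Local v) ⧸
            Subgroup.centralizer ({a} : Set ((cmDatum L 2 (Matrix.of fun i j : Fin 2 => if i.val + j.val + 1 = 2 then (1 : L) else 0)).Local v ×
              (cmDatum L 1 (Matrix.of fun i j : Fin 1 => if i.val + j.val + 1 = 1 then (1 : L) else 0)).Local v)))]
        [∀ (v : HeightOneSpectrum (𝓞 ↥(maximalRealSubfield L))) (γ : (cmDatum L 3 (qsForm L)).Local v),
          BorelSpace ((cmDatum L 3 (qsForm L)).Local v ⧸ Subgroup.centralizer ({γ} : Set ((cmDatum L 3 (qsForm L)).Local v)))]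
        [∀ v, (νG v).IsHaarMeasure] [∀ v, (νG v).IsMulRightInvariant] [∀ v, (νH v).IsHaarMeasure] [∀ v, (νH v).IsMulRightInvariant],
        ∀ (μω : HeckeCharacter L) (hμu : μω.IsUnitary),
        (∀ x : Literature.NumberTheory.GaloisRepresentations.ideleGroup ↥(maximalRealSubfield L),
          μω (AdeleRing.ideleBaseChange (↥(maximalRealSubfield L)) L x) = quadraticHeckeCharCM L x) →
        Δ = finExplicitCollection L (qsForm L) μω (finExplicitDelta_conj_left_all L (qsForm L) μω) (finExplicitDelta_conj_right_all L (qsForm L) μω) →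
        (∀ v : HeightOneSpectrum (𝓞 ↥(maximalRealSubfield L)), (mH v).IsCanonical (IsLocalGRegular L v) (νH v) ∧
          (mG v).IsCanonical (fun γ => IsRegularElt (γ.val : GL (Fin 3) (UnitaryGroup.LocalRing L v))) (νG v)) →
        ∀ (hQS : CMCharIdentityPackageTestSigned L (qsForm L) (F0P3cStCharTSCharField.qsForm_map_cmConjRingHom_transpose L) (F0P3cStCharTSShellOrbitalG.isUnit_det_qsForm L) νH νG μω hμu Δ mH mG),
        (∀ v : HeightOneSpectrum (𝓞 ↥(maximalRealSubfield L)), (∀ w : PlacesOver L v, IsCMField.complexConj L • w.1 = w.1) →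
          IsLocalDeltaTransferExists L (qsForm L) v (Δ v) (mH v) (mG v) Literature.NumberTheory.Rogawski1990.IsLocSmooth
            Literature.NumberTheory.Rogawski1990.IsLocSmooth) →
        ∀ (ξ : OneDimAutRepH L)
          (μA : Measure (adelicGroupData (↥(maximalRealSubfield L)) L (IsCMField.complexConj L) 3 (qsForm L)).automorphicQuotient)
          [(adelicGroupData (↥(maximalRealSubfield L)) L (IsCMField.complexConj L) 3 (qsForm L)).IsAutomorphicMeasure μA]
          (P : DiscreteAutomorphicRep (adelicGroupData (↥(maximalRealSubfield L)) L (IsCMField.complexConj L) 3 (qsForm L)) μA),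
          MemXiFamily P (F0P3cStCharTSCharField.qsForm_map_cmConjRingHom_transpose L) (F0P3cStCharTSShellOrbitalG.isUnit_det_qsForm L) μω hμu ξ →
          ∀ (v : HeightOneSpectrum (𝓞 ↥(maximalRealSubfield L))) (hns : ∀ w : PlacesOver L v, IsCMField.complexConj L • w.1 = w.1),
          ∀ (T : GL (Fin 3) (LocalRing L v)) (a : LocalRing L v) (ha : IsUnit a)
            (h : formCongr (conjLocal L (IsCMField.complexConj L) v) T ((qsForm L).map (algebraMap L (LocalRing L v))) =
              a • (Matrix.of fun i j : Fin 3 => if i.val + j.val + 1 = 3 then (1 : L) else 0).map (algebraMap L (LocalRing L v))),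
          ∀ [MeasurableSpace (Gqs L v ⧸ Subgroup.center (Gqs L v))] [BorelSpace (Gqs L v ⧸ Subgroup.center (Gqs L v))]
            (μZ : Measure (Gqs L v ⧸ Subgroup.center (Gqs L v))) [μZ.IsHaarMeasure],
          ∀ (π2 πn : IrrClass (Gqs L v)),
          ∀ (hK : KeysCaseTwoLabels L v (μω.semilocalComponent L v) (torusLocalComponent L (IsCMField.complexConj L) v ξ.η)
              (torusLocalComponent L (IsCMField.complexConj L) v ξ.ψ) π2 πn)
            (hn : ¬ πn.IsSquareIntegrable μZ),
            -- (QS-U) «SC-UNIQUE ON U(Φ₃)»: every SUPERCUSPIDAL v-constituent of P IS the πˢ(ξ_v) ∘ e read off the SIGNED Q-package `hQS`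
            ∀ c : IrrClass ((cmDatum L 3 (qsForm L)).Local v),
              (IrrClass.comap (localPiEquiv L (IsCMField.complexConj L) 3 (qsForm L) v) c).IsConstituentOf
                  (P.finRep.smoothPart.toRepresentation.comp (inclPlace (↥(maximalRealSubfield L)) L (IsCMField.complexConj L) 3 (qsForm L) v)) →
              c.IsSupercuspidal →
              c = ((hQS ξ).1 v hns T a ha h μZ π2 πn hK hn).πs) :
    ∀ (L : Type) [Field L] [NumberField L] [IsCMField L]
      [∀ v : HeightOneSpectrum (𝓞 ↥(maximalRealSubfield L)), MeasurableSpace ((cmDatum L 3 (qsForm L)).Local v)]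
      [∀ v : HeightOneSpectrum (𝓞 ↥(maximalRealSubfield L)),
        MeasurableSpace ((cmDatum L 2 (Matrix.of fun i j : Fin 2 => if i.val + j.val + 1 = 2 then (1 : L) else 0)).Local v ×
          (cmDatum L 1 (Matrix.of fun i j : Fin 1 => if i.val + j.val + 1 = 1 then (1 : L) else 0)).Local v)]
      [∀ (v : HeightOneSpectrum (𝓞 ↥(maximalRealSubfield L)))
          (a : ((cmDatum L 2 (Matrix.of fun i j : Fin 2 => if i.val + j.val + 1 = 2 then (1 : L) else 0)).Local v ×
            (cmDatum L 1 (Matrix.of fun i j : Fin 1 => if i.val + j.val + 1 = 1 then (1 : L) else 0)).Local v)),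
        MeasurableSpace (((cmDatum L 2 (Matrix.of fun i j : Fin 2 => if i.val + j.val + 1 = 2 then (1 : L) else 0)).Local v ×
            (cmDatum L 1 (Matrix.of fun i j : Fin 1 => if i.val + j.val + 1 = 1 then (1 : L) else 0)).Local v) ⧸
          Subgroup.centralizer ({a} : Set ((cmDatum L 2 (Matrix.of fun i j : Fin 2 => if i.val + j.val + 1 = 2 then (1 : L) else 0)).Local v ×
            (cmDatum L 1 (Matrix.of fun i j : Fin 1 => if i.val + j.val + 1 = 1 then (1 : L) else 0)).Local v)))]
      [∀ (v : HeightOneSpectrum (𝓞 ↥(maximalRealSubfield L))) (γ : (cmDatum L 3 (qsForm L)).Local v),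
        MeasurableSpace ((cmDatum L 3 (qsForm L)).Local v ⧸ Subgroup.centralizer ({γ} : Set ((cmDatum L 3 (qsForm L)).Local v)))]
      (Δ : ∀ v : HeightOneSpectrum (𝓞 ↥(maximalRealSubfield L)), LocalTransferFactor L (qsForm L) v)
      (mH : ∀ v : HeightOneSpectrum (𝓞 ↥(maximalRealSubfield L)),
        OrbitalMeasureFamily ((cmDatum L 2 (Matrix.of fun i j : Fin 2 => if i.val + j.val + 1 = 2 then (1 : L) else 0)).Local v ×
          (cmDatum L 1 (Matrix.of fun i j : Fin 1 => if i.val + j.val + 1 = 1 then (1 : L) else 0)).Local v))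
      (mG : ∀ v : HeightOneSpectrum (𝓞 ↥(maximalRealSubfield L)), OrbitalMeasureFamily ((cmDatum L 3 (qsForm L)).Local v))
      (νG : ∀ v : HeightOneSpectrum (𝓞 ↥(maximalRealSubfield L)), Measure ((cmDatum L 3 (qsForm L)).Local v))
      (νH : ∀ v : HeightOneSpectrum (𝓞 ↥(maximalRealSubfield L)),
        Measure ((cmDatum L 2 (Matrix.of fun i j : Fin 2 => if i.val + j.val + 1 = 2 then (1 : L) else 0)).Local v ×
          (cmDatum L 1 (Matrix.of fun i j : Fin 1 => if i.val + j.val + 1 = 1 then (1 : L) else 0)).Local v))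
      [∀ v : HeightOneSpectrum (𝓞 ↥(maximalRealSubfield L)), BorelSpace ((cmDatum L 3 (qsForm L)).Local v)]
      [∀ v : HeightOneSpectrum (𝓞 ↥(maximalRealSubfield L)),
        BorelSpace ((cmDatum L 2 (Matrix.of fun i j : Fin 2 => if i.val + j.val + 1 = 2 then (1 : L) else 0)).Local v ×
          (cmDatum L 1 (Matrix.of fun i j : Fin 1 => if i.val + j.val + 1 = 1 then (1 : L) else 0)).Local v)]
      [∀ (v : HeightOneSpectrum (𝓞 ↥(maximalRealSubfield L)))
          (a : ((cmDatum L 2 (Matrix.of fun i j : Fin 2 => if i.val + j.val + 1 = 2 then (1 : L) else 0)).Local v ×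
            (cmDatum L 1 (Matrix.of fun i j : Fin 1 => if i.val + j.val + 1 = 1 then (1 : L) else 0)).Local v)),
        BorelSpace (((cmDatum L 2 (Matrix.of fun i j : Fin 2 => if i.val + j.val + 1 = 2 then (1 : L) else 0)).Local v ×
            (cmDatum L 1 (Matrix.of fun i j : Fin 1 => if i.val + j.val + 1 = 1 then (1 : L) else 0)).Local v) ⧸
          Subgroup.centralizer ({a} : Set ((cmDatum L 2 (Matrix.of fun i j : Fin 2 => if i.val + j.val + 1 = 2 then (1 : L) else 0)).Local v ×
            (cmDatum L 1 (Matrix.of fun i j : Fin 1 => if i.val + j.val + 1 = 1 then (1 : L) else 0)).Local v)))]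
      [∀ (v : HeightOneSpectrum (𝓞 ↥(maximalRealSubfield L))) (γ : (cmDatum L 3 (qsForm L)).Local v),
        BorelSpace ((cmDatum L 3 (qsForm L)).Local v ⧸ Subgroup.centralizer ({γ} : Set ((cmDatum L 3 (qsForm L)).Local v)))]
      [∀ v, (νG v).IsHaarMeasure] [∀ v, (νG v).IsMulRightInvariant] [∀ v, (νH v).IsHaarMeasure] [∀ v, (νH v).IsMulRightInvariant],
      ∀ (μω : HeckeCharacter L) (hμu : μω.IsUnitary),
      (∀ x : Literature.NumberTheory.GaloisRepresentations.ideleGroup ↥(maximalRealSubfield L),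
        μω (AdeleRing.ideleBaseChange (↥(maximalRealSubfield L)) L x) = quadraticHeckeCharCM L x) →
      Δ = finExplicitCollection L (qsForm L) μω (finExplicitDelta_conj_left_all L (qsForm L) μω) (finExplicitDelta_conj_right_all L (qsForm L) μω) →
      (∀ v : HeightOneSpectrum (𝓞 ↥(maximalRealSubfield L)), (mH v).IsCanonical (IsLocalGRegular L v) (νH v) ∧
        (mG v).IsCanonical (fun γ => IsRegularElt (γ.val : GL (Fin 3) (UnitaryGroup.LocalRing L v))) (νG v)) →
      ∀ (hQS : CMCharIdentityPackageTestSigned L (qsForm L) (F0P3cStCharTSCharField.qsForm_map_cmConjRingHom_transpose L) (F0P3cStCharTSShellOrbitalG.isUnit_det_qsForm L) νH νG μω hμu Δ mH mG),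
      (∀ v : HeightOneSpectrum (𝓞 ↥(maximalRealSubfield L)), (∀ w : PlacesOver L v, IsCMField.complexConj L • w.1 = w.1) →
        IsLocalDeltaTransferExists L (qsForm L) v (Δ v) (mH v) (mG v) Literature.NumberTheory.Rogawski1990.IsLocSmooth
          Literature.NumberTheory.Rogawski1990.IsLocSmooth) →
      ∀ (ξ : OneDimAutRepH L)
        (μA : Measure (adelicGroupData (↥(maximalRealSubfield L)) L (IsCMField.complexConj L) 3 (qsForm L)).automorphicQuotient)
        [(adelicGroupData (↥(maximalRealSubfield L)) L (IsCMField.complexConj L) 3 (qsForm L)).IsAutomorphicMeasure μA]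
        (P : DiscreteAutomorphicRep (adelicGroupData (↥(maximalRealSubfield L)) L (IsCMField.complexConj L) 3 (qsForm L)) μA),
        MemXiFamily P (F0P3cStCharTSCharField.qsForm_map_cmConjRingHom_transpose L) (F0P3cStCharTSShellOrbitalG.isUnit_det_qsForm L) μω hμu ξ →
        ∀ (v : HeightOneSpectrum (𝓞 ↥(maximalRealSubfield L))) (hns : ∀ w : PlacesOver L v, IsCMField.complexConj L • w.1 = w.1),
        ∀ (T : GL (Fin 3) (LocalRing L v)) (a : LocalRing L v) (ha : IsUnit a)
          (h : formCongr (conjLocal L (IsCMField.complexConj L) v) T ((qsForm L).map (algebraMap L (LocalRing L v))) =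
            a • (Matrix.of fun i j : Fin 3 => if i.val + j.val + 1 = 3 then (1 : L) else 0).map (algebraMap L (LocalRing L v))),
        ∀ [MeasurableSpace (Gqs L v ⧸ Subgroup.center (Gqs L v))] [BorelSpace (Gqs L v ⧸ Subgroup.center (Gqs L v))]
          (μZ : Measure (Gqs L v ⧸ Subgroup.center (Gqs L v))) [μZ.IsHaarMeasure],
        ∀ (π2 πn : IrrClass (Gqs L v)),
        ∀ (hK : KeysCaseTwoLabels L v (μω.semilocalComponent L v) (torusLocalComponent L (IsCMField.complexConj L) v ξ.η)
            (torusLocalComponent L (IsCMField.complexConj L) v ξ.ψ) π2 πn)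
          (hn : ¬ πn.IsSquareIntegrable μZ),
          -- (β)@Φ₃ «every SUPERCUSPIDAL v-constituent of P completes πⁿ ∘ e in the SIGNED (13.1.4) on test functions» (= leaf `StubXiPacketRigidCoreSc` :342 body at `H := qsForm L`)
          ∀ c : IrrClass ((cmDatum L 3 (qsForm L)).Local v),
            (IrrClass.comap (localPiEquiv L (IsCMField.complexConj L) 3 (qsForm L) v) c).IsConstituentOf
                (P.finRep.smoothPart.toRepresentation.comp (inclPlace (↥(maximalRealSubfield L)) L (IsCMField.complexConj L) 3 (qsForm L) v)) →
            c.IsSupercuspidal →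
            (⟨IrrClass.comap (cmDatumLocalCongr L v T ha h).symm πn, some c⟩ : CMLocalAPacket L (qsForm L) v).CharIdentityAtTest L (qsForm L) v
            (fun c' f => (if ∃ z : LocalRing L v, IsUnit z ∧ a = z * conjLocal L (IsCMField.complexConj L) v z then (1 : ℂ) else -1) *
            c'.smoothTrace (νG v) f)
            (ξ.xiLocalChar v) (νH v) (Δ v) (mH v) (mG v) := by
  intro L _ _ _ _ _ _ _ Δ mH mG νG νH _ _ _ _ _ _ _ _ μω hμu hμω hΔ hcan hQS hex ξ μA _ P hmem v hns T a ha h _ _ μZ _ π2 πn hK hn c hc hsc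
  have hcπ : c = ((hQS ξ).1 v hns T a ha h μZ π2 πn hK hn).πs :=
    HU L Δ mH mG νG νH μω hμu hμω hΔ hcan hQS hex ξ μA P hmem v hns T a ha h μZ π2 πn hK hn c hc hsc
  rw [hcπ]
  exact ((hQS ξ).1 v hns T a ha h μZ π2 πn hK hn).charIdentityAtTestSigned_πs

end Summit.HodgeConjecture.HodgeConjecture.R90.S5

end
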